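import Literature.MathematicalPhysics.QuantumFieldTheory.BalabanImbrieJaffe1984to88.BIJ88Normalization46
import Literature.MathematicalPhysics.QuantumFieldTheory.BalabanImbrieJaffe1984to88.BIJ85ScalarPropagatorTorus

/-!
# `BalabanImbrieJaffe1984to88.BIJ88Normalization49Torus` — T. Bałaban, J. Imbrie, A. Jaffe, *Effective action and cluster properties of the
abelian Higgs model*, Commun. Math. Phys. **114** (1988) 257–315 [BalabanImbrieJaffe1988], Sect. 4 p. 275 **(4.9)–(4.11)** — the scalar
normalization factor `Z^{(j)}_{Λ₁₀}(u_k)` — AT THE FIRST STEP ON THE TORUS OF RECORD: for `j = 0` the quadratic form of (4.9) is the basic form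
**(3.31)** p. 270 `½⟨φ^{(0)}, (−Δ_{u₁} + aL⁻²Q(u₁)*Q(u₁))φ^{(0)}⟩`, and on the whole torus (`Λ₁₀ = T₁`, no Dirichlet restriction) it is
POSITIVE DEFINITE FOR EVERY U(1) FIELD `u₁` — so r18 gen 2's closed form `BIJ88Normalization46.Z49_eq`/`log_Z49_sites` holds with its hypothesis
`T.PosDef` DISCHARGED

statement-level skeleton of published theorems with citation tags; proofs where landed; nothing here is a claim about the Yang–Mills mass gap

PDF held: `paper:balaban1988-cmp114-bij-abelian-higgs-effective-action` (journal page = PDF page + 256); p. 275 [PDF 19] text layer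
`~/.lit/texts/…/p0019.txt` read this session (*"Similarly for the scalar field we have Z^{(j)}_{Λ₁₀}(u_k) = ∫𝒟φ_{Λ₁₀} exp(−½⟨Λ₁₀φ,
(Δ^{L^jη}_{j,loc}(u_k) + aL⁻²P(u_k))Λ₁₀φ⟩ − E^{(j)}_{k,s}|Λ₁₀|), (4.9) with P(u_k) = Q(u_k)*Q(u_k), (4.10) E^{(j)}_{k,s} = −(d−2) log L^jη. (4.11)"*);
p. 270 [PDF 14] (3.31) (*"we obtain the basic quadratic forms in φ^{(0)} and ψ: ½⟨φ^{(0)}, (−Δ_{u₁} + aL⁻²Q(u₁)*Q(u₁))φ^{(0)}⟩ + …"*).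

CITATION HEADER (lean-in-tree rule).  Part of the lit-balaban TYPED SKELETON (HOME `run/shared/lean/pub/lit-balaban/`), READER/TYPER seat r18
(C2 §§1–4 fold owner), gen 7, unit `lit-balaban-r18`; rows **C2.Eq4.9** (DEF, typed p244232 `BIJ88Normalization46.Z49` with `Z49_eq`/`log_Z49`
PROVED for `T` positive definite) and **C2.Eq3.31** of `HOME/lit-balaban-r18/ROWS-C2.md`; companion of r18 gen 7's `BIJ88Normalization46Torus`
((4.6) on the torus).  The positivity is p11 gen 2's `BIJ85ScalarPropagatorTorus.hpos_torus` ([BalabanImbrieJaffe1985] (4.6.2): *"no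
restrictions on φ occur in the Gaussian integral"*, no zero modes of `D_u` ∩ `ker Q(u)`).

WHAT IS PROVED (0 `sorry`; definitions with bodies `reIm`, `ofR`, `bform`, `T49`; the rest theorems).
* §1 REAL COORDINATES: `ofR : (T_j × Fin 2 → ℝ) →ₗ[ℝ] FineSp` (two real coordinates per site, as in `BIJ88Normalization46.log_Z49_sites`),
  `ofR_apply`, `ofR_eq_zero_iff`.
* §2 THE FORM: `bform c a u` = the polarisation of `‖D_uφ‖² + a‖Q(u)φ‖²` in real coordinates (`bform_self`), symmetric (`bform_comm`); its
  matrix **`T49 c a u`** (`dot_T49`: `vᵀT v′ = bform v v′`; `dot_T49_self`: `vᵀTv = ‖D_uφ_v‖² + a‖Q(u)φ_v‖²` = twice the (3.31) first form at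
  `φ^{(0)} = φ_v`, with p11's `scalarForm_torus` giving the printed coordinates).
* §3 **`T49_posDef`**: `T49 c a u` is positive definite for EVERY U(1) field `u`, every `a > 0`, `c ≠ 0` (standing range `j + 1 ≤ m + K`).
* §4 **(4.9) at the first step on the torus**: `Z49_torus_eq` (closed form `e^{−E|Λ|}√(2π)^{2|T_j|}/√det T`), `Z49_torus_pos`,
  `log_Z49_torus_sites` (with (4.11) substituted) — r18 gen 2's theorems with `hT` discharged.
HONEST SCOPE.  First step only (`j = 0` of (4.9), where `Δ^{η}_{0,loc}(u) + aL⁻²P(u)` is the basic form (3.31) `−Δ_u + aL⁻²Q(u)*Q(u)`); the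
general `j ≥ 1` needs the positivity of `Δ_{j,loc}(u_k) + aL⁻²P(u_k)` ((2.38)/(2.40), statement rows) and is not claimed; whole torus
(`Λ₁₀ = T`), not a Dirichlet sub-region; `a` stands for the printed `aL⁻²` (> 0) and `c` for the lattice constant of `D_u` (≠ 0); U(1);
NOT summit progress; NOT continuum; NOT Clay.  Imports `BIJ88Normalization46` + `BIJ85ScalarPropagatorTorus`; no Summits import; sub-namespace
`…BIJ88Normalization49Torus`; modifies nothing.
-/

namespace Literature.MathematicalPhysics.QuantumFieldTheory.BalabanImbrieJaffe1984to88.BIJ88Normalization49Torus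

open Literature.MathematicalPhysics.QuantumFieldTheory.Balaban1983to89
open BIJ85ScalarPropagatorTorus (FineSp Dlin Qlin hpos_torus)
open BIJ88Normalization46 (Z49 Z49_eq Z49_pos log_Z49 log_Z49_sites)
open BIJ88Sect3Statements (U1)
open scoped BigOperators Matrix
open Finset

noncomputable section

variable {P : Params} {j : ℕ}

/-! ## §1 Two real coordinates per site -/

/-- the index set of the real integration variables of (4.9): (site, real/imaginary part). [cite: BalabanImbrieJaffe1988, (4.9) p.275] -/
abbrev Idx (P : Params) (j : ℕ) : Type := Balaban1983to89.Site P j × Fin 2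

/-- kernel: the real pairing `Re(z̄w) = Re z Re w + Im z Im w` of two complex numbers. [cite: BalabanImbrieJaffe1985, (2.2) p.302] -/
def reIm (z w : ℂ) : ℝ := z.re * w.re + z.im * w.im

/-- kernel: `Re(z̄z) = |z|²`. [cite: BalabanImbrieJaffe1985, (2.2) p.302] -/
theorem reIm_self (z : ℂ) : reIm z z = ‖z‖ ^ 2 := by
  rw [reIm, Complex.sq_norm, Complex.normSq_apply]

/-- kernel: the pairing is symmetric. [cite: BalabanImbrieJaffe1985, (2.2) p.302] -/
theorem reIm_comm (z w : ℂ) : reIm z w = reIm w z := by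
  unfold reIm; ring

/-- **Real coordinates of the scalar field**: `v ↦ φ_v`, `φ_v(x) = v(x,0) + i v(x,1)` (the `𝒟φ` of (4.9) = Lebesgue measure in these
coordinates, two per site). [cite: BalabanImbrieJaffe1988, (4.9) p.275] -/
def ofR : (Idx P j → ℝ) →ₗ[ℝ] FineSp P j where
  toFun v := WithLp.toLp 2 fun x => (⟨v (x, 0), v (x, 1)⟩ : ℂ)
  map_add' v w := by
    ext x
    simp only [PiLp.add_apply, Pi.add_apply]
    rfl
  map_smul' r v := by
    ext x
    simp only [PiLp.smul_apply, Pi.smul_apply, RingHom.id_apply, Complex.real_smul, smul_eq_mul]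
    apply Complex.ext
    · simp
    · simp

/-- kernel: the value of `ofR`. [cite: BalabanImbrieJaffe1988, (4.9) p.275] -/
theorem ofR_apply (v : Idx P j → ℝ) (x : Balaban1983to89.Site P j) : ofR v x = (⟨v (x, 0), v (x, 1)⟩ : ℂ) := rfl

/-- kernel: `φ_v = 0 ⟺ v = 0`. [cite: BalabanImbrieJaffe1988, (4.9) p.275] -/
theorem ofR_eq_zero_iff (v : Idx P j → ℝ) : ofR v = 0 ↔ v = 0 := by
  constructor
  · intro h
    funext ⟨x, i⟩
    have hx : ofR v x = 0 := by rw [h]; rfl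
    rw [ofR_apply, Complex.ext_iff] at hx
    simp only [Complex.zero_re, Complex.zero_im] at hx
    rcases Fin.exists_fin_two.1 ⟨i, rfl⟩ with hi | hi
    · rw [hi]; exact hx.1
    · rw [hi]; exact hx.2
  · rintro rfl
    exact map_zero _

/-! ## §2 The basic quadratic form (3.31) in real coordinates and its matrix -/

section Form

variable (c a : ℝ) (U : GaugeField P j U1)

/-- **The polarisation of `‖D_uφ‖² + a‖Q(u)φ‖²`** (twice the first basic form (3.31) `½⟨φ,(−Δ_u + aQ(u)*Q(u))φ⟩`, `−Δ_u = D_u*D_u`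
(4.6.3) of [BalabanImbrieJaffe1985], `a` standing for `aL⁻²`) as a real bilinear form in the coordinates `v ↦ φ_v`:
`(v, v′) ↦ Σ_b Re((D_uφ_v)_b̄ (D_uφ_{v′})_b) + a Σ_y Re((Q(u)φ_v)_ȳ (Q(u)φ_{v′})_y)`. [cite: BalabanImbrieJaffe1988, (3.31) p.270] -/
def bform : LinearMap.BilinForm ℝ (Idx P j → ℝ) :=
  LinearMap.mk₂ ℝ
    (fun v w => (∑ b : PBond P j, reIm (Dlin c U (ofR v) b) (Dlin c U (ofR w) b))
      + a * ∑ y : Balaban1983to89.Site P (j + 1), reIm (Qlin U (ofR v) y) (Qlin U (ofR w) y))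
    (fun v₁ v₂ w => by
      simp only [map_add, PiLp.add_apply, reIm, Complex.add_re, Complex.add_im, add_mul, sum_add_distrib]
      ring)
    (fun r v w => by
      simp only [map_smul, PiLp.smul_apply, reIm, Complex.real_smul, Complex.mul_re, Complex.mul_im, Complex.ofReal_re,
        Complex.ofReal_im, zero_mul, sub_zero, add_zero, mul_assoc, ← mul_add, ← mul_sum, smul_eq_mul]
      ring)
    (fun v w₁ w₂ => by
      simp only [map_add, PiLp.add_apply, reIm, Complex.add_re, Complex.add_im, mul_add, sum_add_distrib]
      ring)
    (fun r v w => by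
      simp only [map_smul, PiLp.smul_apply, reIm, Complex.real_smul, Complex.mul_re, Complex.mul_im, Complex.ofReal_re,
        Complex.ofReal_im, zero_mul, sub_zero, add_zero, smul_eq_mul]
      simp only [mul_left_comm _ r, ← mul_add, ← mul_sum])

/-- kernel: the value of the form. [cite: BalabanImbrieJaffe1988, (3.31) p.270] -/
theorem bform_apply (v w : Idx P j → ℝ) :
    bform c a U v w = (∑ b : PBond P j, reIm (Dlin c U (ofR v) b) (Dlin c U (ofR w) b))
      + a * ∑ y : Balaban1983to89.Site P (j + 1), reIm (Qlin U (ofR v) y) (Qlin U (ofR w) y) := rfl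

/-- kernel: the form is symmetric. [cite: BalabanImbrieJaffe1988, (3.31) p.270] -/
theorem bform_comm (v w : Idx P j → ℝ) : bform c a U v w = bform c a U w v := by
  rw [bform_apply, bform_apply]
  congr 1
  · exact sum_congr rfl fun b _ => reIm_comm _ _
  · congr 1
    exact sum_congr rfl fun y _ => reIm_comm _ _

/-- **The diagonal value is the printed exponent**: `bform v v = ‖D_uφ_v‖² + a‖Q(u)φ_v‖²` (= `2 ×` the first form of (3.31) at `φ^{(0)} = φ_v`;
p11's `BIJ85ScalarPropagatorTorus.scalarForm_torus` spells the two norms out in the printed coordinates). [cite: BalabanImbrieJaffe1988, (3.31) p.270] -/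
theorem bform_self (v : Idx P j → ℝ) : bform c a U v v = ‖Dlin c U (ofR v)‖ ^ 2 + a * ‖Qlin U (ofR v)‖ ^ 2 := by
  rw [bform_apply, PiLp.norm_sq_eq_of_L2, PiLp.norm_sq_eq_of_L2]
  simp only [reIm_self]

/-- **The matrix `T` of (4.9) at the first step**: the real `2|T_j| × 2|T_j|` matrix of `−Δ_u + aQ(u)*Q(u)` in the coordinates `φ_v`
(the `T` of r18 gen 2's `BIJ88Normalization46.Z49`). [cite: BalabanImbrieJaffe1988, (4.9) p.275] -/
def T49 : Matrix (Idx P j) (Idx P j) ℝ := LinearMap.BilinForm.toMatrix' (bform c a U)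

/-- kernel: `vᵀT v′ = bform v v′`. [cite: BalabanImbrieJaffe1988, (4.9) p.275] -/
theorem dot_T49 (v w : Idx P j → ℝ) : v ⬝ᵥ (T49 c a U *ᵥ w) = bform c a U v w := by
  rw [← Matrix.toBilin'_apply', T49, Matrix.toBilin'_toMatrix']

/-- kernel: **`vᵀTv = ‖D_uφ_v‖² + a‖Q(u)φ_v‖²`** — the exponent of (4.9) at `j = 0` is `−½vᵀTv` in the coordinates `φ_v`.
[cite: BalabanImbrieJaffe1988, (4.9) p.275] -/
theorem dot_T49_self (v : Idx P j → ℝ) : v ⬝ᵥ (T49 c a U *ᵥ v) = ‖Dlin c U (ofR v)‖ ^ 2 + a * ‖Qlin U (ofR v)‖ ^ 2 := by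
  rw [dot_T49, bform_self]

/-- kernel: `T` is symmetric. [cite: BalabanImbrieJaffe1988, (4.9) p.275] -/
theorem T49_isSymm : (T49 c a U).IsSymm := by
  refine Matrix.IsSymm.ext fun i k => ?_
  simp only [T49, LinearMap.BilinForm.toMatrix'_apply]
  exact bform_comm c a U _ _

/-- kernel: `T` is Hermitian (real symmetric). [cite: BalabanImbrieJaffe1988, (4.9) p.275] -/
theorem T49_isHermitian : (T49 c a U).IsHermitian := by
  rw [Matrix.IsHermitian, Matrix.conjTranspose_eq_transpose_of_trivial]
  exact T49_isSymm c a U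

end Form

/-! ## §3 Positive definiteness for every U(1) field -/

/-- **`T` IS POSITIVE DEFINITE FOR EVERY U(1) FIELD** (`a > 0`, `c ≠ 0`, standing range): `vᵀTv = ‖D_uφ_v‖² + a‖Q(u)φ_v‖² > 0` for
`v ≠ 0` by p11's `hpos_torus` (no zero modes: `D_uφ = 0 ∧ Q(u)φ = 0 ⇒ φ = 0`, [BalabanImbrieJaffe1985] (4.6.2) *"no restrictions on φ occur
in the Gaussian integral"*) — the hypothesis `hT : T.PosDef` of `BIJ88Normalization46.Z49_eq` DISCHARGED at the first step.
[cite: BalabanImbrieJaffe1988, (4.9) p.275] -/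
theorem T49_posDef (hj : j + 1 ≤ P.m + P.K) {c : ℝ} (hc : c ≠ 0) {a : ℝ} (ha : 0 < a) (U : GaugeField P j U1) :
    (T49 c a U).PosDef := by
  refine Matrix.posDef_iff_dotProduct_mulVec.2 ⟨T49_isHermitian c a U, fun v hv => ?_⟩
  rw [star_trivial, dot_T49_self]
  exact hpos_torus hj hc ha U (ofR v) fun h => hv ((ofR_eq_zero_iff v).1 h)

/-! ## §4 (4.9) at the first step on the torus -/

/-- kernel: two real coordinates per site. [cite: BalabanImbrieJaffe1988, (4.9) p.275] -/
theorem card_Idx : Fintype.card (Idx P j) = 2 * Fintype.card (Balaban1983to89.Site P j) := by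
  rw [Fintype.card_prod, Fintype.card_fin, mul_comm]

/-- **(4.9) EVALUATED AT THE FIRST STEP ON THE TORUS**, for every U(1) field `u`, `a > 0`, `c ≠ 0`, any constants `E`, `N` (the printed
`E^{(j)}_{k,s}`, `|Λ₁₀|`): `Z = e^{−EN} · √(2π)^{2|T_j|} / √(det T)` — r18 gen 2's `Z49_eq` with `T.PosDef` discharged by `T49_posDef`.
[cite: BalabanImbrieJaffe1988, (4.9) p.275] -/
theorem Z49_torus_eq (hj : j + 1 ≤ P.m + P.K) {c : ℝ} (hc : c ≠ 0) {a : ℝ} (ha : 0 < a) (U : GaugeField P j U1) (E N : ℝ) :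
    Z49 (T49 c a U) E N =
      Real.exp (-(E * N)) * (Real.sqrt (2 * Real.pi) ^ (2 * Fintype.card (Balaban1983to89.Site P j)) / Real.sqrt (T49 c a U).det) := by
  rw [Z49_eq _ (T49_posDef hj hc ha U), card_Idx]

/-- (4.9) at the first step on the torus is a positive number. [cite: BalabanImbrieJaffe1988, (4.9) p.275] -/
theorem Z49_torus_pos (hj : j + 1 ≤ P.m + P.K) {c : ℝ} (hc : c ≠ 0) {a : ℝ} (ha : 0 < a) (U : GaugeField P j U1) (E N : ℝ) :
    0 < Z49 (T49 c a U) E N :=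
  Z49_pos _ (T49_posDef hj hc ha U) E N

/-- **`log Z` at the first step on the torus with (4.11) substituted** (`E = E^{(j)}_{k,s} = −(d−2) log L^jη`, `N = |Λ₁₀| = |T_j|`):
`log Z = |T_j|·((d−2) log L^jη + log 2π) − ½ log det T` — r18 gen 2's `log_Z49_sites` with `T.PosDef` discharged.
[cite: BalabanImbrieJaffe1988, (4.11) p.275] -/
theorem log_Z49_torus_sites (hj : j + 1 ≤ P.m + P.K) {c : ℝ} (hc : c ≠ 0) {a : ℝ} (ha : 0 < a) (U : GaugeField P j U1)
    (d : ℕ) (Ljη : ℝ) :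
    Real.log (Z49 (T49 c a U) (BIJ88Sect4Statements.Eks d Ljη) (Fintype.card (Balaban1983to89.Site P j))) =
      (Fintype.card (Balaban1983to89.Site P j) : ℝ) * (((d : ℝ) - 2) * Real.log Ljη + Real.log (2 * Real.pi))
        - (1 / 2 : ℝ) * Real.log (T49 c a U).det :=
  log_Z49_sites _ (T49_posDef hj hc ha U) d _ Ljη card_Idx

end

end Literature.MathematicalPhysics.QuantumFieldTheory.BalabanImbrieJaffe1984to88.BIJ88Normalization49Torus
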